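import Mathlib

/-!
# Tuning rigidity of the band: window avoidance forces a fat jet (discrete)

Solo-blind programme, steady door R4c, paper §24.19 (c) Steps 3–5 made into a theorem about
finite sequences.

Setting.  Leaves `0, …, N` across the band; `u j` is the leaf speed-up (the leaf-function part `Φ′`
of the mean-flow response) and `leafStep u j = u (j+1) − u j = h·Φ″` the tuned step (shear times
leaf spacing).  Two hypotheses, both dischargeable leaf by leaf:

* `OffWindow u N us δ` — WINDOW AVOIDANCE: at every leaf that is not a fat slow-down
  (`−us < u j`) the step is tuned away from zero, `δ ≤ step ∨ step ≤ −δ`.  This is the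
  marginality principle N1 (`marginality_pointwise` of `SoloBlindMarginality`: no leaf of a positive
  steady pattern is more than `4ε²` supercritical) read through the exact two-parameter leaf map
  `F_c(u, μ) = (1+u)·σ(c; μ/(1+u))`: the supercritical window `{F_c > K₀ + 4ε²}` contains, above
  every speed-up `u > −u⁻(c)`, a shear interval `(μ₋, μ₊) ∋ 0`, so an admissible leaf with
  `u > −us` has `|μ| ≥ m`, i.e. `|step| ≥ δ := m·h`.
* `NoWindowJump u N δ` — NO WINDOW JUMPING: adjacent steps differ by less than `δ`
  (`|Φ‴| < m/h`, a regularity far weaker than smoothness at the layer scale `ℓ ≫ h`).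

Conclusions (no other input):

* `climb_after_exit`, `descent_before_entry` — once the speed-up leaves the slow zone it climbs
  with steps `≥ δ` to the end of the band, and symmetrically before entering it;
* `sojourn_interval` — the slow-down sojourn `{u ≤ −us}` is an interval of leaves;
* `monotone_of_no_sojourn` — without a sojourn the speed-up is monotone with steps `≥ δ`
  (or `≤ −δ`) throughout;
* `fat_block` — STRUCTURE THEOREM: there is a block of consecutive leaves of length
  `L ≥ (N + 1 − 2⌈2us/δ⌉)/3` on which either `us ≤ u` throughout (fat jet) or `u ≤ −us`
  throughout (fat slow-down).  Since `⌈2us/δ⌉·h ≈ 2us/m` is an `h`-independent LENGTH, the fat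
  block has `h`-independent physical length once `us` is small against `m·|band|`;
* `mass_floor_of_fat_run` — testing the leaf-mean balance `c_H Φ′ + K₀h²Φ⁗ = G[q] + N[q]`
  against a nonnegative bump `χ` on the fat block (`|Σ χ c u| ≤ C·mass + r`) gives the floor
  `us·c₀·Σχ ≤ C·mass + r`.

So inside the caricature of §24.19 (d) the floor needs exactly: N1 (landed), the window form of the
leaf map (H-loc/H-sat), no window jumping, and the tested balance (H-bal).  Elementary real
analysis of finite sequences only.
-/

namespace Summit.AnomalousDissipation.AnomalousDissipation.Theorems

/-- Forward step of the leaf speed-up: `u (j+1) − u j` (`= h·Φ″` at leaf `j`). -/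
def leafStep (u : ℕ → ℝ) (j : ℕ) : ℝ := u (j + 1) - u j

/-- Window avoidance on leaves `0 … N−1`: a leaf that is not a fat slow-down has a tuned step. -/
def OffWindow (u : ℕ → ℝ) (N : ℕ) (us δ : ℝ) : Prop :=
  ∀ j, j < N → -us < u j → δ ≤ leafStep u j ∨ leafStep u j ≤ -δ

/-- No window jumping: adjacent steps differ by less than the window width `δ`. -/
def NoWindowJump (u : ℕ → ℝ) (N : ℕ) (δ : ℝ) : Prop :=
  ∀ j, j + 1 < N → |leafStep u (j + 1) - leafStep u j| < δ

section structure_theorem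

variable {u : ℕ → ℝ} {N : ℕ} {us δ : ℝ}

/-- Sign persistence (positive): a thin-or-fast leaf following a positively tuned leaf is positively
tuned. -/
theorem step_pos_persist (hW : OffWindow u N us δ) (hC : NoWindowJump u N δ) (hδ : 0 < δ)
    {j : ℕ} (hj : j + 1 < N) (hu : -us < u (j + 1)) (hs : δ ≤ leafStep u j) :
    δ ≤ leafStep u (j + 1) := by
  rcases hW (j + 1) hj hu with h | h
  · exact h
  · exfalso
    have hlt := (abs_lt.mp (hC j hj)).1
    linarith

/-- Sign persistence (negative). -/
theorem step_neg_persist (hW : OffWindow u N us δ) (hC : NoWindowJump u N δ) (hδ : 0 < δ)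
    {j : ℕ} (hj : j + 1 < N) (hu : -us < u (j + 1)) (hs : leafStep u j ≤ -δ) :
    leafStep u (j + 1) ≤ -δ := by
  rcases hW (j + 1) hj hu with h | h
  · exfalso
    have hlt := (abs_lt.mp (hC j hj)).2
    linarith
  · exact h

/-- **Climb after exit.** If leaf `a` is slow (`u a ≤ −us`) and leaf `a+1` is not, then every later
leaf `a+1+k ≤ N` is not slow, the speed-up has grown by at least `k·δ`, and (while a forward step
exists) the step is `≥ δ`. -/
theorem climb_after_exit (hW : OffWindow u N us δ) (hC : NoWindowJump u N δ) (hδ : 0 < δ)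
    {a : ℕ} (ha : u a ≤ -us) (ha1 : -us < u (a + 1)) :
    ∀ k, a + 1 + k ≤ N →
      -us < u (a + 1 + k) ∧ u (a + 1) + k * δ ≤ u (a + 1 + k) ∧
        (a + 1 + k < N → δ ≤ leafStep u (a + 1 + k)) := by
  intro k
  induction k with
  | zero =>
    intro _
    refine ⟨by simpa using ha1, by simp, ?_⟩
    intro hlt
    have hlt' : a + 1 < N := by simpa using hlt
    have hsa : 0 < leafStep u a := by unfold leafStep; linarith
    rcases hW (a + 1) hlt' (by simpa using ha1) with h | h
    · simpa using h
    · exfalso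
      have hj := (abs_lt.mp (hC a hlt')).1
      linarith
  | succ k ih =>
    intro hN
    have hlt : a + 1 + k < N := by omega
    obtain ⟨_, h2, h3⟩ := ih hlt.le
    have hs : δ ≤ u (a + 1 + k + 1) - u (a + 1 + k) := h3 hlt
    have e : a + 1 + (k + 1) = a + 1 + k + 1 := by ring
    have hu' : -us < u (a + 1 + k + 1) := by linarith
    refine ⟨by rw [e]; exact hu', by rw [e]; push_cast; linarith, ?_⟩
    intro hlt2
    rw [e] at hlt2 ⊢
    exact step_pos_persist hW hC hδ hlt2 hu' hs

/-- **Descent before entry.** If leaf `bp+1 ≤ N` is slow and leaf `bp` is not, then every earlier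
leaf `j = bp − k` is not slow, its step is `≤ −δ`, and `u j ≥ u bp + k·δ`. -/
theorem descent_before_entry (hW : OffWindow u N us δ) (hC : NoWindowJump u N δ) (hδ : 0 < δ)
    {bp : ℕ} (hbN : bp + 1 ≤ N) (hb : u (bp + 1) ≤ -us) (hbp : -us < u bp) :
    ∀ k j, j + k = bp → -us < u j ∧ leafStep u j ≤ -δ ∧ u bp + k * δ ≤ u j := by
  intro k
  induction k with
  | zero =>
    intro j hj
    have hj' : j = bp := by simpa using hj
    subst hj'
    refine ⟨hbp, ?_, by simp⟩
    have hneg : leafStep u j < 0 := by unfold leafStep; linarith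
    rcases hW j (by omega) hbp with h | h
    · exfalso; linarith
    · exact h
  | succ k ih =>
    intro j hj
    obtain ⟨h1, h2, h3⟩ := ih (j + 1) (by omega)
    have hj1 : j + 1 < N := by omega
    have hjump := (abs_lt.mp (hC j hj1)).1
    have hs_neg : leafStep u j < 0 := by linarith
    have hs_def : leafStep u j = u (j + 1) - u j := rfl
    have huj : -us < u j := by linarith
    rcases hW j (by omega) huj with h | h
    · exfalso; linarith
    · refine ⟨huj, h, ?_⟩
      push_cast
      linarith

/-- **The sojourn is an interval.** Between two slow leaves every leaf is slow. -/
theorem sojourn_interval (hW : OffWindow u N us δ) (hC : NoWindowJump u N δ) (hδ : 0 < δ)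
    {a j b : ℕ} (haj : a ≤ j) (hjb : j ≤ b) (hbN : b ≤ N)
    (ha : u a ≤ -us) (hb : u b ≤ -us) : u j ≤ -us := by
  classical
  by_contra hj
  push Not at hj
  have hPa' : u (Nat.findGreatest (fun i => u i ≤ -us) j) ≤ -us :=
    Nat.findGreatest_spec (P := fun i => u i ≤ -us) haj ha
  have ha'j : Nat.findGreatest (fun i => u i ≤ -us) j ≤ j := Nat.findGreatest_le j
  have hmax : ∀ i, i ≤ j → u i ≤ -us → i ≤ Nat.findGreatest (fun i => u i ≤ -us) j :=
    fun i hi hP => Nat.le_findGreatest (P := fun i => u i ≤ -us) hi hP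
  set a' := Nat.findGreatest (fun i => u i ≤ -us) j with ha'_def
  have ha'lt : a' < j := by
    rcases lt_or_eq_of_le ha'j with h | h
    · exact h
    · exfalso; rw [h] at hPa'; linarith
  have hnext : -us < u (a' + 1) := by
    by_contra h
    push Not at h
    have : a' + 1 ≤ a' := hmax (a' + 1) (by omega) h
    omega
  obtain ⟨h1, -, -⟩ := climb_after_exit hW hC hδ hPa' hnext (b - (a' + 1)) (by omega)
  have e : a' + 1 + (b - (a' + 1)) = b := by omega
  rw [e] at h1
  linarith

/-- **No sojourn ⇒ monotone.** If no leaf is slow, the steps are all `≥ δ` or all `≤ −δ`. -/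
theorem monotone_of_no_sojourn (hW : OffWindow u N us δ) (hC : NoWindowJump u N δ) (hδ : 0 < δ)
    (hall : ∀ j, j ≤ N → -us < u j) :
    (∀ i, i < N → δ ≤ leafStep u i) ∨ (∀ i, i < N → leafStep u i ≤ -δ) := by
  rcases Nat.eq_zero_or_pos N with hN | hN
  · left; intro i hi; omega
  rcases hW 0 hN (hall 0 (Nat.zero_le _)) with h0 | h0
  · left
    intro i
    induction i with
    | zero => intro _; exact h0
    | succ i ih =>
      intro hi
      exact step_pos_persist hW hC hδ hi (hall (i + 1) hi.le) (ih (by omega))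
  · right
    intro i
    induction i with
    | zero => intro _; exact h0
    | succ i ih =>
      intro hi
      exact step_neg_persist hW hC hδ hi (hall (i + 1) hi.le) (ih (by omega))

/-- Growth along an increasing run from leaf `0`: `u j ≥ u 0 + j·δ` for `j ≤ N`. -/
theorem growth_from_zero (hinc : ∀ i, i < N → δ ≤ leafStep u i) :
    ∀ j, j ≤ N → u 0 + j * δ ≤ u j := by
  intro j
  induction j with
  | zero => intro _; simp
  | succ j ih =>
    intro hj
    have h := hinc j (by omega)
    unfold leafStep at h
    have := ih (by omega)
    push_cast
    linarith

/-- Growth (backwards) along a decreasing run ending at leaf `N`: `u j ≥ u N + (N − j)·δ`. -/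
theorem growth_to_end (hdec : ∀ i, i < N → leafStep u i ≤ -δ) :
    ∀ k j, j + k = N → u N + k * δ ≤ u j := by
  intro k
  induction k with
  | zero => intro j hj; simp at hj; subst hj; simp
  | succ k ih =>
    intro j hj
    have h := hdec j (by omega)
    unfold leafStep at h
    have := ih (j + 1) (by omega)
    push_cast
    linarith

/-- **Structure theorem (fat block).** Under window avoidance and no window jumping (with
`0 < δ`; for the intended reading `0 < us`) there is a block of consecutive leaves `a, …, a+L−1 ≤ N` with
`3L + 2⌈2us/δ⌉ ≥ N + 1` on which the speed-up is a fat jet (`us ≤ u`) or a fat slow-down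
(`u ≤ −us`) throughout. -/
theorem fat_block (hW : OffWindow u N us δ) (hC : NoWindowJump u N δ) (hδ : 0 < δ) :
    ∃ a L : ℕ, a + L ≤ N + 1 ∧ ((N : ℝ) + 1 ≤ 3 * L + 2 * (⌈2 * us / δ⌉₊ : ℕ)) ∧
      ((∀ j, a ≤ j → j < a + L → us ≤ u j) ∨ (∀ j, a ≤ j → j < a + L → u j ≤ -us)) := by
  have hct : ∀ a b : ℕ, (a : ℝ) - b ≤ ((a - b : ℕ) : ℝ) := by
    intro a b
    rcases Nat.lt_or_ge a b with h | h
    · rw [Nat.sub_eq_zero_of_le h.le]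
      have : (a : ℝ) < b := by exact_mod_cast h
      push_cast
      linarith
    · rw [Nat.cast_sub h]
  classical
  set K : ℕ := ⌈2 * us / δ⌉₊ with hK_def
  have hK : 2 * us ≤ (K : ℝ) * δ := by
    have h1 : 2 * us / δ ≤ (K : ℝ) := Nat.le_ceil _
    rwa [div_le_iff₀ hδ] at h1
  -- a step count ≥ K buys 2us of speed-up
  have hbuy : ∀ k : ℕ, K ≤ k → 2 * us ≤ (k : ℝ) * δ := by
    intro k hk
    have : (K : ℝ) ≤ k := by exact_mod_cast hk
    nlinarith
  by_cases hex : ∃ j, j ≤ N ∧ u j ≤ -us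
  · -- Case A: a slow-down sojourn exists: first slow leaf a₀, last slow leaf a₁
    set a₀ := Nat.find hex with ha₀_def
    have ha₀ : a₀ ≤ N ∧ u a₀ ≤ -us := Nat.find_spec hex
    have ha₀min : ∀ j, j < a₀ → j ≤ N → -us < u j := by
      intro j hj hjN
      by_contra h; push Not at h
      exact absurd (Nat.find_min' hex ⟨hjN, h⟩) (by omega)
    have ha₁ : u (Nat.findGreatest (fun j => u j ≤ -us) N) ≤ -us :=
      Nat.findGreatest_spec (P := fun j => u j ≤ -us) ha₀.1 ha₀.2
    have ha₁N : Nat.findGreatest (fun j => u j ≤ -us) N ≤ N := Nat.findGreatest_le N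
    have hmax : ∀ j, j ≤ N → u j ≤ -us → j ≤ Nat.findGreatest (fun j => u j ≤ -us) N :=
      fun j hj hP => Nat.le_findGreatest (P := fun j => u j ≤ -us) hj hP
    set a₁ := Nat.findGreatest (fun j => u j ≤ -us) N with ha₁_def
    have ha₀₁ : a₀ ≤ a₁ := hmax a₀ ha₀.1 ha₀.2
    have ha₁max : ∀ j, a₁ < j → j ≤ N → -us < u j := by
      intro j hj hjN
      by_contra h; push Not at h
      have := hmax j hjN h
      omega
    -- the three blocks and their lengths
    -- (1) initial fast block [0, a₀ - K)
    have blk1 : ∀ j, j < a₀ - K → us ≤ u j := by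
      intro j hj
      have hbp : 1 ≤ a₀ := by omega
      obtain ⟨bp, hbp'⟩ : ∃ bp, a₀ = bp + 1 := ⟨a₀ - 1, by omega⟩
      have hbpN : bp + 1 ≤ N := by omega
      have hslow : u (bp + 1) ≤ -us := by rw [← hbp']; exact ha₀.2
      have hfast : -us < u bp := ha₀min bp (by omega) (by omega)
      obtain ⟨-, -, h3⟩ := descent_before_entry hW hC hδ hbpN hslow hfast (bp - j) j (by omega)
      have hk : K ≤ bp - j := by omega
      have := hbuy (bp - j) hk
      linarith
    -- (2) middle slow block [a₀, a₁]
    have blk2 : ∀ j, a₀ ≤ j → j < a₀ + (a₁ + 1 - a₀) → u j ≤ -us := by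
      intro j hj1 hj2
      exact sojourn_interval hW hC hδ hj1 (by omega) ha₁N ha₀.2 ha₁
    -- (3) final fast block [a₁ + 1 + K, N]
    have blk3 : ∀ j, min (a₁ + 1 + K) (N + 1) ≤ j →
        j < min (a₁ + 1 + K) (N + 1) + (N - a₁ - K) → us ≤ u j := by
      intro j hj1' hj2
      have hj1 : a₁ + 1 + K ≤ j := by omega
      have hjN : j ≤ N := by omega
      have hnext : -us < u (a₁ + 1) := ha₁max (a₁ + 1) (by omega) (by omega)
      obtain ⟨-, h2, -⟩ := climb_after_exit hW hC hδ ha₁ hnext (j - (a₁ + 1)) (by omega)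
      have e : a₁ + 1 + (j - (a₁ + 1)) = j := by omega
      rw [e] at h2
      have hk : K ≤ j - (a₁ + 1) := by omega
      have := hbuy (j - (a₁ + 1)) hk
      linarith
    -- lengths add up to ≥ N + 1 - 2K
    have hsum : (N : ℝ) + 1 - 2 * K ≤
        ((a₀ - K : ℕ) : ℝ) + ((a₁ + 1 - a₀ : ℕ) : ℝ) + ((N - a₁ - K : ℕ) : ℝ) := by
      have e1 := hct a₀ K
      have e2 : ((a₁ + 1 - a₀ : ℕ) : ℝ) = (a₁ : ℝ) + 1 - a₀ := by
        rw [Nat.cast_sub (by omega)]; push_cast; ring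
      have e3 : ((N - a₁ - K : ℕ) : ℝ) ≥ (N : ℝ) - a₁ - K := by
        have := hct (N - a₁) K
        rw [Nat.cast_sub ha₁N] at this
        exact this
      linarith
    by_cases h2 : (N : ℝ) + 1 ≤ 3 * ((a₁ + 1 - a₀ : ℕ) : ℝ) + 2 * K
    · exact ⟨a₀, a₁ + 1 - a₀, by omega, h2, Or.inr blk2⟩
    by_cases h1 : (N : ℝ) + 1 ≤ 3 * ((a₀ - K : ℕ) : ℝ) + 2 * K
    · refine ⟨0, a₀ - K, by omega, h1, Or.inl ?_⟩
      intro j _ hj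
      exact blk1 j (by omega)
    · refine ⟨min (a₁ + 1 + K) (N + 1), N - a₁ - K, by omega, ?_, Or.inl blk3⟩
      push Not at h1 h2
      linarith
  · -- Case B: no sojourn; the speed-up is monotone across the whole band
    push Not at hex
    have hall : ∀ j, j ≤ N → -us < u j := fun j hj => hex j hj
    rcases monotone_of_no_sojourn hW hC hδ hall with hinc | hdec
    · -- increasing: leaves K … N are fast
      refine ⟨min K (N + 1), N + 1 - K, by omega, ?_, Or.inl ?_⟩
      · have := hct (N + 1) K
        push_cast at this
        linarith
      · intro j hj1 hj2
        have hjN : j ≤ N := by omega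
        have hKj : K ≤ j := by omega
        have hg := growth_from_zero hinc j hjN
        have h0 := hall 0 (Nat.zero_le _)
        have := hbuy j hKj
        linarith
    · -- decreasing: leaves 0 … N - K are fast
      refine ⟨0, N + 1 - K, by omega, ?_, Or.inl ?_⟩
      · have := hct (N + 1) K
        push_cast at this
        linarith
      · intro j _ hj2
        have hjN : j ≤ N := by omega
        have hg := growth_to_end hdec (N - j) j (by omega)
        have hN := hall N le_rfl
        have hk : K ≤ N - j := by omega
        have := hbuy (N - j) hk
        linarith

end structure_theorem

/-- **Mass floor from a fat run (tested balance).** On a block `B` of leaves where the speed-up is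
a fat jet or a fat slow-down, testing the leaf-mean balance against a bump `χ ≥ 0` with
`|Σ χ c u| ≤ C·m + r` (`c ≥ c₀ ≥ 0` the transport coefficient `c_H`, `m` the Reynolds-stress mass,
`r` the fourth-order remainder) yields `us·c₀·Σ χ ≤ C·m + r`. -/
theorem mass_floor_of_fat_run (B : Finset ℕ) (χ c u : ℕ → ℝ) (us c0 C m r : ℝ)
    (hχ : ∀ j ∈ B, 0 ≤ χ j) (hc : ∀ j ∈ B, c0 ≤ c j) (hc0 : 0 ≤ c0) (hus : 0 ≤ us)
    (hfat : (∀ j ∈ B, us ≤ u j) ∨ (∀ j ∈ B, u j ≤ -us))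
    (hbal : |∑ j ∈ B, χ j * c j * u j| ≤ C * m + r) :
    us * c0 * ∑ j ∈ B, χ j ≤ C * m + r := by
  rw [Finset.mul_sum]
  rcases hfat with h | h
  · have hle : ∑ j ∈ B, us * c0 * χ j ≤ ∑ j ∈ B, χ j * c j * u j := by
      apply Finset.sum_le_sum
      intro j hj
      have h1 := hχ j hj; have h2 := hc j hj; have h3 := h j hj
      have h4 : 0 ≤ c j := le_trans hc0 h2
      have h5 : 0 ≤ u j := le_trans hus h3
      calc us * c0 * χ j ≤ u j * c0 * χ j := by gcongr
        _ ≤ u j * c j * χ j := by gcongr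
        _ = χ j * c j * u j := by ring
    exact le_trans hle (le_trans (le_abs_self _) hbal)
  · have hle : ∑ j ∈ B, us * c0 * χ j ≤ -∑ j ∈ B, χ j * c j * u j := by
      rw [← Finset.sum_neg_distrib]
      apply Finset.sum_le_sum
      intro j hj
      have h1 := hχ j hj; have h2 := hc j hj; have h3 := h j hj
      have h4 : 0 ≤ c j := le_trans hc0 h2
      have h5 : us ≤ -u j := by linarith
      have h6 : 0 ≤ -u j := le_trans hus h5
      calc us * c0 * χ j ≤ (-u j) * c0 * χ j := by gcongr
        _ ≤ (-u j) * c j * χ j := by gcongr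
        _ = -(χ j * c j * u j) := by ring
    exact le_trans hle (le_trans (neg_le_abs _) hbal)

end Summit.AnomalousDissipation.AnomalousDissipation.Theorems
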